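import Mathlib
import HarnessLib
import Summits.AtomisticToContinuum.HydrodynamicLimit.Theses.OneFlightGossipEngine
import Summits.AtomisticToContinuum.HydrodynamicLimit.Theses.TwoClocks

/-!
# `KineticCurrentsWindowLD` from the η₀-uniform docking node

Route `OneFlightGossipEngine`, item stmt-AtomisticToContinuum-9530 (`KineticCurrentsWindowLD`,
support since the rev-7 re-dock) is the profile-wise special case of the crux
stmt-AtomisticToContinuum-14662 (`KineticCurrentsWindowLDUniform`): given continuous profiles
`a > 0`, `θ₀ > 0`, `u₀` on the compact torus, put `S := ⨆ x, a x` (finite and positive),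
`I := ∫ a` (positive) and `σ₀ := min 1 (η₀ I / S)`; then for `0 < σ < σ₀` one has
`σ³ ≤ σ < η₀ I / S`, i.e. the packing guard `σ³ · S ≤ η₀ · I` of the uniform node, whose
conclusion is then literally that of `KineticCurrentsWindowLD`.

This file proves that reduction (pure logic plus the two positivity facts); it supports the item
without closing it (the docking node is the route's open crux). It also records that the docking node,
hence the item, follows from route TwoClocks' general-`F` node `KineticWindowLDUniform`
(stmt-AtomisticToContinuum-14442) by restriction to the structured class (whose members are continuous).

Dependency drift (2026-08-17 repair of a fullbuild breakage): item stmt-AtomisticToContinuum-9530 was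
closed as MOOT on 2026-08-16 (the rev-7 re-dock made the η₀-uniform node the route's statement) and the
Theses module no longer declares `KineticCurrentsWindowLD`. The two reductions concluding it are
re-landed as `kineticCurrentsWindowLDProfilewise_of_uniform` / `kineticCurrentsWindowLDProfilewise_of_twoClocks`,
which spell out its proposition verbatim (the ledger signature of stmt-9530, unchanged) as their
conclusion, with the same hypotheses and proofs — so both still say exactly "the uniform node implies
the profile-wise window-LD statement"; the rev-7 names `kineticCurrentsWindowLD_of_uniform` /
`kineticCurrentsWindowLD_of_twoClocks` are kept as deprecated aliases (append-only).
-/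

namespace Summit.AtomisticToContinuum.HydrodynamicLimit.Theorems

open MeasureTheory
open Summit.AtomisticToContinuum.HydrodynamicLimit.Theses.OneFlightGossipEngine

/-- A continuous positive function on the flat unit `3`-torus has positive, finite supremum
which bounds it pointwise, and positive integral (Haar probability volume, positive on open
sets). [folklore] -/
theorem torus_profile_sup_integral_pos
    (a : Literature.MathematicalPhysics.KineticTheory.T3 → ℝ) (ha : Continuous a)
    (ha0 : ∀ x, 0 < a x) :
    (∀ x, a x ≤ ⨆ y, a y) ∧ (0 < ⨆ y, a y) ∧ 0 < ∫ x, a x := by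
  have hbdd : BddAbove (Set.range a) := (isCompact_range ha).bddAbove
  have hle : ∀ x, a x ≤ ⨆ y, a y := fun x => le_ciSup hbdd x
  refine ⟨hle, lt_of_lt_of_le (ha0 0) (hle 0), ?_⟩
  exact ha.integral_pos_of_hasCompactSupport_nonneg_nonzero
    (HasCompactSupport.of_compactSpace a) (fun x => (ha0 x).le) (ha0 0).ne'

/-- **Reduction.** The η₀-uniform docking node `KineticCurrentsWindowLDUniform`
(stmt-AtomisticToContinuum-14662) implies the profile-wise finite-kinetic-window LD statement
`KineticCurrentsWindowLD` (stmt-AtomisticToContinuum-9530, moot since 2026-08-16 and no longer a Theses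
declaration — its proposition is written out as the conclusion), profile by profile, with
`σ₀ := min 1 (η₀ ∫a / sup a)`: for `0 < σ < σ₀`, `σ³ ≤ σ < η₀ ∫a / sup a` gives the packing
guard `σ³ · sup a ≤ η₀ · ∫a`. [folklore] -/
theorem kineticCurrentsWindowLDProfilewise_of_uniform (hU : KineticCurrentsWindowLDUniform) :
    -- the proposition of the moot item `KineticCurrentsWindowLD` (stmt-9530), verbatim:
      ∀ (a θ₀ : Literature.MathematicalPhysics.KineticTheory.T3 → ℝ) (u₀ :
      Literature.MathematicalPhysics.KineticTheory.T3 →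
      Literature.MathematicalPhysics.KineticTheory.V3), Continuous a → Continuous θ₀ → Continuous u₀ →
      (∀ x, 0 < a x) → (∀ x, 0 < θ₀ x) → ∃ σ₀ : ℝ, 0 < σ₀ ∧ ∀ σ : ℝ, 0 < σ → σ < σ₀ → ∀ Φ : (N : ℕ) →
      Literature.Analysis.FluidPDE.HardSphereFlow (Literature.Analysis.FluidPDE.Torus.geometry (Fin
      3)) (Literature.MathematicalPhysics.KineticTheory.hsDiameter σ N) (N + 1), ∀ (A :
      Literature.MathematicalPhysics.KineticTheory.T3 → Fin 3 → Fin 3 → ℝ) (b :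
      Literature.MathematicalPhysics.KineticTheory.T3 →
      Literature.MathematicalPhysics.KineticTheory.V3) (G :
      Literature.MathematicalPhysics.KineticTheory.T3 × ℝ → ℝ), Continuous A → Continuous b →
      Continuous G → (∃ C : ℝ, ∀ y : Literature.MathematicalPhysics.KineticTheory.T3 ×
      Literature.MathematicalPhysics.KineticTheory.V3, |(fun y :
      Literature.MathematicalPhysics.KineticTheory.T3 ×
      Literature.MathematicalPhysics.KineticTheory.V3 => ((∑ j : Fin 3, ∑ k : Fin 3, A y.1 j k * ((y.2
      - u₀ y.1) j * (y.2 - u₀ y.1) k)) + (∑ j : Fin 3, b y.1 j * (y.2 - u₀ y.1) j) * G (y.1, ‖y.2 - u₀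
      y.1‖ ^ 2))) y| ≤ C * (1 + ‖y.2‖ ^ 2)) → (∀ x, ∫ v, (fun y :
      Literature.MathematicalPhysics.KineticTheory.T3 ×
      Literature.MathematicalPhysics.KineticTheory.V3 => ((∑ j : Fin 3, ∑ k : Fin 3, A y.1 j k * ((y.2
      - u₀ y.1) j * (y.2 - u₀ y.1) k)) + (∑ j : Fin 3, b y.1 j * (y.2 - u₀ y.1) j) * G (y.1, ‖y.2 - u₀
      y.1‖ ^ 2))) (x, v) * Literature.Analysis.FluidPDE.localMaxwellian 1 (θ₀ x) (u₀ x) v = 0) → (∀ x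
      (j : Fin 3), ∫ v, (fun y : Literature.MathematicalPhysics.KineticTheory.T3 ×
      Literature.MathematicalPhysics.KineticTheory.V3 => ((∑ j : Fin 3, ∑ k : Fin 3, A y.1 j k * ((y.2
      - u₀ y.1) j * (y.2 - u₀ y.1) k)) + (∑ j : Fin 3, b y.1 j * (y.2 - u₀ y.1) j) * G (y.1, ‖y.2 - u₀
      y.1‖ ^ 2))) (x, v) * v j * Literature.Analysis.FluidPDE.localMaxwellian 1 (θ₀ x) (u₀ x) v = 0) →
      (∀ x, ∫ v, (fun y : Literature.MathematicalPhysics.KineticTheory.T3 ×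
      Literature.MathematicalPhysics.KineticTheory.V3 => ((∑ j : Fin 3, ∑ k : Fin 3, A y.1 j k * ((y.2
      - u₀ y.1) j * (y.2 - u₀ y.1) k)) + (∑ j : Fin 3, b y.1 j * (y.2 - u₀ y.1) j) * G (y.1, ‖y.2 - u₀
      y.1‖ ^ 2))) (x, v) * ‖v‖ ^ 2 * Literature.Analysis.FluidPDE.localMaxwellian 1 (θ₀ x) (u₀ x) v =
      0) → ∃ β₀ : ℝ, 0 < β₀ ∧ ∀ β : ℝ, |β| ≤ β₀ → ∀ ε : ℝ, 0 < ε → ∃ τ : ℝ, 0 < τ ∧ ∃ N₀ : ℕ, ∀ N : ℕ,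
      N₀ ≤ N → ∫⁻ z, ENNReal.ofReal (Real.exp (β * ∑ i : Fin (N + 1), (τ * ((N : ℝ) + 1) ^ (-(1 / 3 :
      ℝ)))⁻¹ * ∫ r in (0 : ℝ)..(τ * ((N : ℝ) + 1) ^ (-(1 / 3 : ℝ))), (fun y :
      Literature.MathematicalPhysics.KineticTheory.T3 ×
      Literature.MathematicalPhysics.KineticTheory.V3 => ((∑ j : Fin 3, ∑ k : Fin 3, A y.1 j k * ((y.2
      - u₀ y.1) j * (y.2 - u₀ y.1) k)) + (∑ j : Fin 3, b y.1 j * (y.2 - u₀ y.1) j) * G (y.1, ‖y.2 - u₀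
      y.1‖ ^ 2))) (((Φ N).flow r z) i))) ∂(Literature.MathematicalPhysics.KineticTheory.localGibbsLaw
      σ a u₀ θ₀ N (Φ N)) ≤ ENNReal.ofReal (Real.exp (ε * ((N : ℝ) + 1))) := by
  intro a θ₀ u₀ ha hθ hu ha0 hθ0
  obtain ⟨η₀, hη₀, hη⟩ := hU
  obtain ⟨hle, hS, hI⟩ := torus_profile_sup_integral_pos a ha ha0
  set S : ℝ := ⨆ y, a y with hSdef
  set I : ℝ := ∫ x, a x with hIdef
  have hq : 0 < η₀ * I / S := div_pos (mul_pos hη₀ hI) hS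
  refine ⟨min 1 (η₀ * I / S), lt_min one_pos hq, ?_⟩
  intro σ hσ hσlt Φ A b G hA hb hG hC h1 hv hE
  have hσ1 : σ < 1 := lt_of_lt_of_le hσlt (min_le_left _ _)
  have hσq : σ < η₀ * I / S := lt_of_lt_of_le hσlt (min_le_right _ _)
  have hσ3 : σ ^ 3 ≤ σ := by
    have h2 : σ ^ 2 ≤ 1 := by nlinarith
    nlinarith
  have hguard : σ ^ 3 * S ≤ η₀ * I := by
    have : σ ^ 3 < η₀ * I / S := lt_of_le_of_lt hσ3 hσq
    rw [lt_div_iff₀ hS] at this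
    exact this.le
  exact hη a θ₀ u₀ ha hθ hu ha0 hθ0 σ hσ hguard Φ A b G hA hb hG hC h1 hv hE

/-- Deprecated rev-7 name of `kineticCurrentsWindowLDProfilewise_of_uniform`: its landed statement
concluded the Theses declaration `KineticCurrentsWindowLD` (stmt-AtomisticToContinuum-9530), which the
route module no longer declares since the item was closed as moot (2026-08-16); the primed-by-name
successor concludes the same proposition written out. [folklore] -/
@[deprecated kineticCurrentsWindowLDProfilewise_of_uniform (since := "2026-08-17")]
alias kineticCurrentsWindowLD_of_uniform := kineticCurrentsWindowLDProfilewise_of_uniform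

/-- Members of the items' functional class `F(x,v) = A(x):w⊗w + (b(x)·w) G(x,‖w‖²)`, `w = v - u₀(x)`,
are continuous for continuous `A, b, G, u₀`. [folklore] -/
theorem continuous_kcwFunctional
    {A : Literature.MathematicalPhysics.KineticTheory.T3 → Fin 3 → Fin 3 → ℝ}
    {b : Literature.MathematicalPhysics.KineticTheory.T3 → Literature.MathematicalPhysics.KineticTheory.V3}
    {G : Literature.MathematicalPhysics.KineticTheory.T3 × ℝ → ℝ}
    {u₀ : Literature.MathematicalPhysics.KineticTheory.T3 → Literature.MathematicalPhysics.KineticTheory.V3}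
    (hA : Continuous A) (hb : Continuous b) (hG : Continuous G) (hu : Continuous u₀) :
    Continuous fun y : Literature.MathematicalPhysics.KineticTheory.T3 ×
        Literature.MathematicalPhysics.KineticTheory.V3 =>
      ((∑ j : Fin 3, ∑ k : Fin 3, A y.1 j k * ((y.2 - u₀ y.1) j * (y.2 - u₀ y.1) k)) +
        (∑ j : Fin 3, b y.1 j * (y.2 - u₀ y.1) j) * G (y.1, ‖y.2 - u₀ y.1‖ ^ 2)) := by
  have hw : Continuous fun y : Literature.MathematicalPhysics.KineticTheory.T3 ×
      Literature.MathematicalPhysics.KineticTheory.V3 => y.2 - u₀ y.1 :=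
    continuous_snd.sub (hu.comp continuous_fst)
  have hwj : ∀ j : Fin 3, Continuous fun y : Literature.MathematicalPhysics.KineticTheory.T3 ×
      Literature.MathematicalPhysics.KineticTheory.V3 => (y.2 - u₀ y.1) j := fun j =>
    (PiLp.continuous_apply 2 (fun _ : Fin 3 => ℝ) j).comp hw
  have hAjk : ∀ j k : Fin 3, Continuous fun x : Literature.MathematicalPhysics.KineticTheory.T3 => A x j k :=
    fun j k => (continuous_apply k).comp ((continuous_apply j).comp hA)
  have hbj : ∀ j : Fin 3, Continuous fun x : Literature.MathematicalPhysics.KineticTheory.T3 => b x j :=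
    fun j => (PiLp.continuous_apply 2 (fun _ : Fin 3 => ℝ) j).comp hb
  refine (continuous_finsetSum _ fun j _ => continuous_finsetSum _ fun k _ =>
    ((hAjk j k).comp continuous_fst).mul ((hwj j).mul (hwj k))).add
    ((continuous_finsetSum _ fun j _ => ((hbj j).comp continuous_fst).mul (hwj j)).mul
      (hG.comp (continuous_fst.prodMk (hw.norm.pow 2))))

/-- **Cross-route reduction.** Route TwoClocks' docking node `KineticWindowLDUniform`
(stmt-AtomisticToContinuum-14442: all continuous `F` of quadratic growth orthogonal to the collision
invariants) implies this route's docking node `KineticCurrentsWindowLDUniform` (stmt-14662) by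
restriction to the structured class. [folklore] -/
theorem kineticCurrentsWindowLDUniform_of_twoClocks
    (h : Summit.AtomisticToContinuum.HydrodynamicLimit.Theses.TwoClocks.KineticWindowLDUniform) :
    KineticCurrentsWindowLDUniform := by
  obtain ⟨η₀, hη₀, hη⟩ := h
  refine ⟨η₀, hη₀, ?_⟩
  intro a θ₀ u₀ ha hθ hu ha0 hθ0 σ hσ hguard Φ A b G hA hb hG
  exact hη a θ₀ u₀ ha hθ hu ha0 hθ0 σ hσ hguard Φ (fun y : Literature.MathematicalPhysics.KineticTheory.T3 ×
        Literature.MathematicalPhysics.KineticTheory.V3 =>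
      ((∑ j : Fin 3, ∑ k : Fin 3, A y.1 j k * ((y.2 - u₀ y.1) j * (y.2 - u₀ y.1) k)) +
        (∑ j : Fin 3, b y.1 j * (y.2 - u₀ y.1) j) * G (y.1, ‖y.2 - u₀ y.1‖ ^ 2)))
    (continuous_kcwFunctional hA hb hG hu)

/-- Hence `KineticWindowLDUniform` (TwoClocks, stmt-14442) also implies the (moot, written-out)
profile-wise statement `KineticCurrentsWindowLD` (stmt-9530). [folklore] -/
theorem kineticCurrentsWindowLDProfilewise_of_twoClocks
    (h : Summit.AtomisticToContinuum.HydrodynamicLimit.Theses.TwoClocks.KineticWindowLDUniform) :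
    -- the proposition of the moot item `KineticCurrentsWindowLD` (stmt-9530), verbatim:
      ∀ (a θ₀ : Literature.MathematicalPhysics.KineticTheory.T3 → ℝ) (u₀ :
      Literature.MathematicalPhysics.KineticTheory.T3 →
      Literature.MathematicalPhysics.KineticTheory.V3), Continuous a → Continuous θ₀ → Continuous u₀ →
      (∀ x, 0 < a x) → (∀ x, 0 < θ₀ x) → ∃ σ₀ : ℝ, 0 < σ₀ ∧ ∀ σ : ℝ, 0 < σ → σ < σ₀ → ∀ Φ : (N : ℕ) →
      Literature.Analysis.FluidPDE.HardSphereFlow (Literature.Analysis.FluidPDE.Torus.geometry (Fin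
      3)) (Literature.MathematicalPhysics.KineticTheory.hsDiameter σ N) (N + 1), ∀ (A :
      Literature.MathematicalPhysics.KineticTheory.T3 → Fin 3 → Fin 3 → ℝ) (b :
      Literature.MathematicalPhysics.KineticTheory.T3 →
      Literature.MathematicalPhysics.KineticTheory.V3) (G :
      Literature.MathematicalPhysics.KineticTheory.T3 × ℝ → ℝ), Continuous A → Continuous b →
      Continuous G → (∃ C : ℝ, ∀ y : Literature.MathematicalPhysics.KineticTheory.T3 ×
      Literature.MathematicalPhysics.KineticTheory.V3, |(fun y :
      Literature.MathematicalPhysics.KineticTheory.T3 ×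
      Literature.MathematicalPhysics.KineticTheory.V3 => ((∑ j : Fin 3, ∑ k : Fin 3, A y.1 j k * ((y.2
      - u₀ y.1) j * (y.2 - u₀ y.1) k)) + (∑ j : Fin 3, b y.1 j * (y.2 - u₀ y.1) j) * G (y.1, ‖y.2 - u₀
      y.1‖ ^ 2))) y| ≤ C * (1 + ‖y.2‖ ^ 2)) → (∀ x, ∫ v, (fun y :
      Literature.MathematicalPhysics.KineticTheory.T3 ×
      Literature.MathematicalPhysics.KineticTheory.V3 => ((∑ j : Fin 3, ∑ k : Fin 3, A y.1 j k * ((y.2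
      - u₀ y.1) j * (y.2 - u₀ y.1) k)) + (∑ j : Fin 3, b y.1 j * (y.2 - u₀ y.1) j) * G (y.1, ‖y.2 - u₀
      y.1‖ ^ 2))) (x, v) * Literature.Analysis.FluidPDE.localMaxwellian 1 (θ₀ x) (u₀ x) v = 0) → (∀ x
      (j : Fin 3), ∫ v, (fun y : Literature.MathematicalPhysics.KineticTheory.T3 ×
      Literature.MathematicalPhysics.KineticTheory.V3 => ((∑ j : Fin 3, ∑ k : Fin 3, A y.1 j k * ((y.2
      - u₀ y.1) j * (y.2 - u₀ y.1) k)) + (∑ j : Fin 3, b y.1 j * (y.2 - u₀ y.1) j) * G (y.1, ‖y.2 - u₀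
      y.1‖ ^ 2))) (x, v) * v j * Literature.Analysis.FluidPDE.localMaxwellian 1 (θ₀ x) (u₀ x) v = 0) →
      (∀ x, ∫ v, (fun y : Literature.MathematicalPhysics.KineticTheory.T3 ×
      Literature.MathematicalPhysics.KineticTheory.V3 => ((∑ j : Fin 3, ∑ k : Fin 3, A y.1 j k * ((y.2
      - u₀ y.1) j * (y.2 - u₀ y.1) k)) + (∑ j : Fin 3, b y.1 j * (y.2 - u₀ y.1) j) * G (y.1, ‖y.2 - u₀
      y.1‖ ^ 2))) (x, v) * ‖v‖ ^ 2 * Literature.Analysis.FluidPDE.localMaxwellian 1 (θ₀ x) (u₀ x) v =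
      0) → ∃ β₀ : ℝ, 0 < β₀ ∧ ∀ β : ℝ, |β| ≤ β₀ → ∀ ε : ℝ, 0 < ε → ∃ τ : ℝ, 0 < τ ∧ ∃ N₀ : ℕ, ∀ N : ℕ,
      N₀ ≤ N → ∫⁻ z, ENNReal.ofReal (Real.exp (β * ∑ i : Fin (N + 1), (τ * ((N : ℝ) + 1) ^ (-(1 / 3 :
      ℝ)))⁻¹ * ∫ r in (0 : ℝ)..(τ * ((N : ℝ) + 1) ^ (-(1 / 3 : ℝ))), (fun y :
      Literature.MathematicalPhysics.KineticTheory.T3 ×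
      Literature.MathematicalPhysics.KineticTheory.V3 => ((∑ j : Fin 3, ∑ k : Fin 3, A y.1 j k * ((y.2
      - u₀ y.1) j * (y.2 - u₀ y.1) k)) + (∑ j : Fin 3, b y.1 j * (y.2 - u₀ y.1) j) * G (y.1, ‖y.2 - u₀
      y.1‖ ^ 2))) (((Φ N).flow r z) i))) ∂(Literature.MathematicalPhysics.KineticTheory.localGibbsLaw
      σ a u₀ θ₀ N (Φ N)) ≤ ENNReal.ofReal (Real.exp (ε * ((N : ℝ) + 1))) :=
  kineticCurrentsWindowLDProfilewise_of_uniform (kineticCurrentsWindowLDUniform_of_twoClocks h)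

/-- Deprecated rev-7 name of `kineticCurrentsWindowLDProfilewise_of_twoClocks` (its landed statement
concluded the retired Theses declaration `KineticCurrentsWindowLD`, stmt-AtomisticToContinuum-9530).
[folklore] -/
@[deprecated kineticCurrentsWindowLDProfilewise_of_twoClocks (since := "2026-08-17")]
alias kineticCurrentsWindowLD_of_twoClocks := kineticCurrentsWindowLDProfilewise_of_twoClocks

end Summit.AtomisticToContinuum.HydrodynamicLimit.Theorems
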